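import Mathlib
import Literature.Probability.Percolation.PercolationProofs
import Literature.Probability.LatticeModels.ProdBernoulliIndependence
import HarnessLib

/-! # Crux `PercNearOneGluing.AdditiveGluing` (stmt-CriticalPhenomena-4576), line
`replica-splice-at-entrance` — stub `stub_knThm2Good`, auxiliary file 2 (events)

Helper file for the crux skeleton `Lines/replica_splice_at_entrance.lean` (lead
prover-line-stmt-CriticalPhenomena-4576-c3-0), stub `stub_knThm2Good` = Kozma–Nitzan,
arXiv:2401.12397, **Theorem 2** (pp. 8–9).  Lands with `--supports stmt-CriticalPhenomena-4576`.

## Content: the event bookkeeping of KN's proof of Theorem 2 (pp. 8–9)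

On the finite weighted graph `Fin n` (`μ = prodBernoulli w`, events `{x ↔ y} = openConn x y`),
for relays `a₁, a₂, a₃`, observer `o`, target `b`, with the separation events
`N₁₂ = {a₁ ↮ a₃} ∩ {a₂ ↮ a₃}`, `N₁ = {a₁ ↮ a₂} ∩ {a₁ ↮ a₃}`, `N₂ = {a₂ ↮ a₁} ∩ {a₂ ↮ a₃}`:
* `knThm2_sep_*` — the conditioning events `{S ↮ X}` of the set-BHK inequalities for
  `S = {a₁, a₂}, X = {a₃}` and `S = {a₁}, X = {a₂, a₃}` are `N₁₂`, `N₁`;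
* `knThm2_m*`, `knThm2_tau_sub` — the atoms `m_T = μ(C(b) ∩ A = T)` written on the separation
  events, and `μ(a₁ ↔ b) − μ(a₃ ↔ b) = (m₁₂ + m₁) − (m₂₃ + m₃)`;
* `knThm2_partA`, `knThm2_partB` — the two expansions of p. 8:
  `μ(o ↔ A, o ↔ b) = μ(o ↔ b, o ↔ a₃) + T₁₂ + T₁ + T₂` (by `C(o) ∩ A`) and
  `μ(o ↔ A, a₃ ↔ b) = μ(o ↔ b, o ↔ a₃) + U₁ + U₂ + U₁₂` (by `C(b) ∩ A`), whose difference is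
  KN's `I + II + III`.
All statements are pointwise identities of events plus finite additivity.
-/

namespace Summit.CriticalPhenomena.PercolationContinuityZ3.Theorems

open MeasureTheory Set
open Literature.Probability.LatticeModels (prodBernoulli)
open Literature.Probability.Percolation (BondConfig openConn openGraph)
open SimpleGraph (Reachable)

noncomputable section
open Classical

variable {n : ℕ}

/-- Membership in the connection event `{x ↔ y}`. [folklore] -/
theorem knThm2_mem_openConn (ω : BondConfig (Fin n)) (x y : Fin n) :
    ω ∈ (openConn x y : Set (BondConfig (Fin n))) ↔ (openGraph ω).Reachable x y := Iff.rfl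

/-- `{x ↔ y} = {y ↔ x}`. [folklore] -/
theorem knThm2_openConn_comm (x y : Fin n) :
    (openConn x y : Set (BondConfig (Fin n))) = openConn y x :=
  Set.ext fun _ => ⟨fun h => Reachable.symm h, fun h => Reachable.symm h⟩

/-! ### The conditioning events of the set-BHK inequalities -/

/-- `{S ↮ X} = N₁₂` for `S = {a₁, a₂}`, `X = {a₃} ⊆ V`. [folklore] -/
theorem knThm2_sep_pair_set (a₁ a₂ a₃ : Fin n) :
    {ω : BondConfig (Fin n) | ∀ s ∈ ({a₁, a₂} : Finset (Fin n)), ∀ x ∈ ({a₃} : Set (Fin n)),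
        ¬ (openGraph ω).Reachable s x} = (openConn a₁ a₃)ᶜ ∩ (openConn a₂ a₃)ᶜ := by
  ext ω
  simp only [Finset.mem_insert, Finset.mem_singleton, Set.mem_singleton_iff, forall_eq_or_imp,
    forall_eq, Set.mem_setOf_eq, Set.mem_inter_iff, Set.mem_compl_iff, knThm2_mem_openConn]

/-- `{S ↮ S'} = N₁₂` for `S = {a₁, a₂}`, `S' = {a₃}` (finsets). [folklore] -/
theorem knThm2_sep_pair_finset (a₁ a₂ a₃ : Fin n) :
    {ω : BondConfig (Fin n) | ∀ s ∈ ({a₁, a₂} : Finset (Fin n)), ∀ x ∈ ({a₃} : Finset (Fin n)),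
        ¬ (openGraph ω).Reachable s x} = (openConn a₁ a₃)ᶜ ∩ (openConn a₂ a₃)ᶜ := by
  ext ω
  simp only [Finset.mem_insert, Finset.mem_singleton, forall_eq_or_imp, forall_eq,
    Set.mem_setOf_eq, Set.mem_inter_iff, Set.mem_compl_iff, knThm2_mem_openConn]

/-- `{S ↮ X} = N₁` for `S = {a₁}`, `X = {a₂, a₃} ⊆ V`. [folklore] -/
theorem knThm2_sep_single_set (a₁ a₂ a₃ : Fin n) :
    {ω : BondConfig (Fin n) | ∀ s ∈ ({a₁} : Finset (Fin n)), ∀ x ∈ ({a₂, a₃} : Set (Fin n)),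
        ¬ (openGraph ω).Reachable s x} = (openConn a₁ a₂)ᶜ ∩ (openConn a₁ a₃)ᶜ := by
  ext ω
  simp only [Finset.mem_singleton, Set.mem_insert_iff, Set.mem_singleton_iff, forall_eq_or_imp,
    forall_eq, Set.mem_setOf_eq, Set.mem_inter_iff, Set.mem_compl_iff, knThm2_mem_openConn]

/-- `{S ↮ S'} = N₁` for `S = {a₁}`, `S' = {a₂, a₃}` (finsets). [folklore] -/
theorem knThm2_sep_single_finset (a₁ a₂ a₃ : Fin n) :
    {ω : BondConfig (Fin n) | ∀ s ∈ ({a₁} : Finset (Fin n)), ∀ x ∈ ({a₂, a₃} : Finset (Fin n)),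
        ¬ (openGraph ω).Reachable s x} = (openConn a₁ a₂)ᶜ ∩ (openConn a₁ a₃)ᶜ := by
  ext ω
  simp only [Finset.mem_insert, Finset.mem_singleton, forall_eq_or_imp, forall_eq,
    Set.mem_setOf_eq, Set.mem_inter_iff, Set.mem_compl_iff, knThm2_mem_openConn]

/-! ### The atoms `m_T = μ(C(b) ∩ A = T)` on the separation events -/

/-- `m₃`: `{b↔a₃} ∩ {b↮a₁} ∩ {b↮a₂} = N₁₂ ∩ {a₃↔b}`. [cite: KozmaNitzan2024, §3.2 (definition of m_S, p. 8)] -/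
theorem knThm2_m3 (b a₁ a₂ a₃ : Fin n) :
    (openConn b a₃ ∩ (openConn b a₁)ᶜ ∩ (openConn b a₂)ᶜ : Set (BondConfig (Fin n))) =
      (openConn a₁ a₃)ᶜ ∩ (openConn a₂ a₃)ᶜ ∩ openConn a₃ b := by
  ext ω
  simp only [Set.mem_inter_iff, Set.mem_compl_iff, knThm2_mem_openConn]
  constructor
  · rintro ⟨⟨h3, h1⟩, h2⟩
    exact ⟨⟨fun h => h1 (h3.trans h.symm), fun h => h2 (h3.trans h.symm)⟩, h3.symm⟩
  · rintro ⟨⟨h13, h23⟩, h3⟩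
    exact ⟨⟨h3.symm, fun h => h13 (h.symm.trans h3.symm)⟩, fun h => h23 (h.symm.trans h3.symm)⟩

/-- `m₁₂`: `{b↔a₁} ∩ {b↔a₂} ∩ {b↮a₃} = N₁₂ ∩ ({a₁↔b} ∩ {a₂↔b})`. [cite: KozmaNitzan2024, §3.2 (definition of m_S, p. 8)] -/
theorem knThm2_m12 (b a₁ a₂ a₃ : Fin n) :
    (openConn b a₁ ∩ openConn b a₂ ∩ (openConn b a₃)ᶜ : Set (BondConfig (Fin n))) =
      (openConn a₁ a₃)ᶜ ∩ (openConn a₂ a₃)ᶜ ∩ (openConn a₁ b ∩ openConn a₂ b) := by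
  ext ω
  simp only [Set.mem_inter_iff, Set.mem_compl_iff, knThm2_mem_openConn]
  constructor
  · rintro ⟨⟨h1, h2⟩, h3⟩
    exact ⟨⟨fun h => h3 (h1.trans h), fun h => h3 (h2.trans h)⟩, h1.symm, h2.symm⟩
  · rintro ⟨⟨h13, -⟩, h1, h2⟩
    exact ⟨⟨h1.symm, h2.symm⟩, fun h => h13 (h1.trans h)⟩

/-- `({a₁↔b} ∖ {a₃↔b}) ∩ {a₂↔b} = N₁₂ ∩ ({a₁↔b} ∩ {a₂↔b})` (`= m₁₂`). [folklore] -/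
theorem knThm2_mA (b a₁ a₂ a₃ : Fin n) :
    ((openConn a₁ b \ openConn a₃ b) ∩ openConn a₂ b : Set (BondConfig (Fin n))) =
      (openConn a₁ a₃)ᶜ ∩ (openConn a₂ a₃)ᶜ ∩ (openConn a₁ b ∩ openConn a₂ b) := by
  ext ω
  simp only [Set.mem_inter_iff, Set.mem_compl_iff, Set.mem_sdiff, knThm2_mem_openConn]
  constructor
  · rintro ⟨⟨h1, h3⟩, h2⟩
    exact ⟨⟨fun h => h3 (h.symm.trans h1), fun h => h3 (h.symm.trans h2)⟩, h1, h2⟩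
  · rintro ⟨⟨h13, -⟩, h1, h2⟩
    exact ⟨⟨h1, fun h => h13 (h1.trans h.symm)⟩, h2⟩

/-- `({a₁↔b} ∖ {a₃↔b}) ∖ {a₂↔b} = N₁ ∩ {a₁↔b}` (`= m₁`). [folklore] -/
theorem knThm2_mB (b a₁ a₂ a₃ : Fin n) :
    ((openConn a₁ b \ openConn a₃ b) \ openConn a₂ b : Set (BondConfig (Fin n))) =
      (openConn a₁ a₂)ᶜ ∩ (openConn a₁ a₃)ᶜ ∩ openConn a₁ b := by
  ext ω
  simp only [Set.mem_inter_iff, Set.mem_compl_iff, Set.mem_sdiff, knThm2_mem_openConn]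
  constructor
  · rintro ⟨⟨h1, h3⟩, h2⟩
    exact ⟨⟨fun h => h2 (h.symm.trans h1), fun h => h3 (h.symm.trans h1)⟩, h1⟩
  · rintro ⟨⟨h12, h13⟩, h1⟩
    exact ⟨⟨h1, fun h => h13 (h1.trans h.symm)⟩, fun h => h12 (h1.trans h.symm)⟩

/-- `({a₃↔b} ∖ {a₁↔b}) ∩ {a₂↔b} = N₁ ∩ ({a₂↔b} ∩ {a₃↔b})` (`= m₂₃`). [folklore] -/
theorem knThm2_mC (b a₁ a₂ a₃ : Fin n) :
    ((openConn a₃ b \ openConn a₁ b) ∩ openConn a₂ b : Set (BondConfig (Fin n))) =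
      (openConn a₁ a₂)ᶜ ∩ (openConn a₁ a₃)ᶜ ∩ (openConn a₂ b ∩ openConn a₃ b) := by
  ext ω
  simp only [Set.mem_inter_iff, Set.mem_compl_iff, Set.mem_sdiff, knThm2_mem_openConn]
  constructor
  · rintro ⟨⟨h3, h1⟩, h2⟩
    exact ⟨⟨fun h => h1 (h.trans h2), fun h => h1 (h.trans h3)⟩, h2, h3⟩
  · rintro ⟨⟨h12, -⟩, h2, h3⟩
    exact ⟨⟨h3, fun h => h12 (h.trans h2.symm)⟩, h2⟩

/-- `({a₃↔b} ∖ {a₁↔b}) ∖ {a₂↔b} = N₁₂ ∩ {a₃↔b}` (`= m₃`). [folklore] -/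
theorem knThm2_mD (b a₁ a₂ a₃ : Fin n) :
    ((openConn a₃ b \ openConn a₁ b) \ openConn a₂ b : Set (BondConfig (Fin n))) =
      (openConn a₁ a₃)ᶜ ∩ (openConn a₂ a₃)ᶜ ∩ openConn a₃ b := by
  ext ω
  simp only [Set.mem_inter_iff, Set.mem_compl_iff, Set.mem_sdiff, knThm2_mem_openConn]
  constructor
  · rintro ⟨⟨h3, h1⟩, h2⟩
    exact ⟨⟨fun h => h1 (h.trans h3), fun h => h2 (h.trans h3)⟩, h3⟩
  · rintro ⟨⟨h13, h23⟩, h3⟩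
    exact ⟨⟨h3, fun h => h13 (h.trans h3.symm)⟩, fun h => h23 (h.trans h3.symm)⟩

/-- **`τ₁ − τ₃` on the atoms**: `μ(a₁↔b) − μ(a₃↔b) = (m₁₂ + m₁) − (m₂₃ + m₃)` (partition of
`{a₁↔b} ∖ {a₃↔b}` and `{a₃↔b} ∖ {a₁↔b}` by `{a₂↔b}`).
[cite: KozmaNitzan2024, Theorem 2, proof (p. 9, "τ₁ − τ₃ = m₁ + m₁₂ − m₃ − m₂₃")] -/
theorem knThm2_tau_sub (w : Sym2 (Fin n) → unitInterval) (b a₁ a₂ a₃ : Fin n) :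
    (prodBernoulli w).real (openConn a₁ b) - (prodBernoulli w).real (openConn a₃ b) =
      ((prodBernoulli w).real
            ((openConn a₁ a₃)ᶜ ∩ (openConn a₂ a₃)ᶜ ∩ (openConn a₁ b ∩ openConn a₂ b)) +
          (prodBernoulli w).real ((openConn a₁ a₂)ᶜ ∩ (openConn a₁ a₃)ᶜ ∩ openConn a₁ b)) -
        ((prodBernoulli w).real
            ((openConn a₁ a₂)ᶜ ∩ (openConn a₁ a₃)ᶜ ∩ (openConn a₂ b ∩ openConn a₃ b)) +
          (prodBernoulli w).real ((openConn a₁ a₃)ᶜ ∩ (openConn a₂ a₃)ᶜ ∩ openConn a₃ b)) := by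
  have hm : ∀ s : Set (BondConfig (Fin n)), MeasurableSet s := fun _ => MeasurableSet.of_discrete
  have h1 := measureReal_inter_add_sdiff (μ := prodBernoulli w) (s := openConn a₁ b)
    (hm (openConn a₃ b))
  have h3 := measureReal_inter_add_sdiff (μ := prodBernoulli w) (s := openConn a₃ b)
    (hm (openConn a₁ b))
  have h1' := measureReal_inter_add_sdiff (μ := prodBernoulli w)
    (s := openConn a₁ b \ openConn a₃ b) (hm (openConn a₂ b))
  have h3' := measureReal_inter_add_sdiff (μ := prodBernoulli w)
    (s := openConn a₃ b \ openConn a₁ b) (hm (openConn a₂ b))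
  rw [knThm2_mA, knThm2_mB] at h1'
  rw [knThm2_mC, knThm2_mD] at h3'
  rw [Set.inter_comm (openConn a₃ b) (openConn a₁ b)] at h3
  linarith

/-! ### Partition A: `{o ↔ A} ∩ {o ↔ b}` by `C(o) ∩ A` -/

/-- `T₁₂`: on `{o↔A, o↔b, o↮a₃}`, the part `{o↔a₁, o↔a₂}` is
`N₁₂ ∩ ({a₁↔o} ∪ {a₂↔o}) ∩ {a₁↔b} ∩ {a₂↔b}`. [cite: KozmaNitzan2024, Theorem 2, proof (p. 8)] -/
theorem knThm2_setA2 (o b a₁ a₂ a₃ : Fin n) :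
    ((((openConn o a₁ ∪ openConn o a₂ ∪ openConn o a₃) ∩ openConn o b) \ openConn o a₃) ∩
        openConn o a₁ ∩ openConn o a₂ : Set (BondConfig (Fin n))) =
      (openConn a₁ a₃)ᶜ ∩ (openConn a₂ a₃)ᶜ ∩
        ((openConn a₁ o ∪ openConn a₂ o) ∩ (openConn a₁ b ∩ openConn a₂ b)) := by
  ext ω
  simp only [Set.mem_inter_iff, Set.mem_union, Set.mem_compl_iff, Set.mem_sdiff,
    knThm2_mem_openConn]
  constructor
  · rintro ⟨⟨⟨⟨-, hb⟩, h3⟩, h1⟩, h2⟩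
    exact ⟨⟨fun h => h3 (h1.trans h), fun h => h3 (h2.trans h)⟩, Or.inl h1.symm,
      h1.symm.trans hb, h2.symm.trans hb⟩
  · rintro ⟨⟨h13, -⟩, hS, h1b, h2b⟩
    have h1 : (openGraph ω).Reachable o a₁ :=
      hS.elim (fun h => h.symm) fun h => (h.symm.trans h2b).trans h1b.symm
    have h2 : (openGraph ω).Reachable o a₂ :=
      hS.elim (fun h => (h.symm.trans h1b).trans h2b.symm) fun h => h.symm
    exact ⟨⟨⟨⟨Or.inl (Or.inl h1), h1.trans h1b⟩, fun h => h13 (h1.symm.trans h)⟩, h1⟩, h2⟩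

/-- `T₁`: on `{o↔A, o↔b, o↮a₃}`, the part `{o↔a₁, o↮a₂}` is `N₁ ∩ {a₁↔o} ∩ {a₁↔b}`.
[cite: KozmaNitzan2024, Theorem 2, proof (p. 8)] -/
theorem knThm2_setA3 (o b a₁ a₂ a₃ : Fin n) :
    (((((openConn o a₁ ∪ openConn o a₂ ∪ openConn o a₃) ∩ openConn o b) \ openConn o a₃) ∩
        openConn o a₁) \ openConn o a₂ : Set (BondConfig (Fin n))) =
      (openConn a₁ a₂)ᶜ ∩ (openConn a₁ a₃)ᶜ ∩ (openConn a₁ o ∩ openConn a₁ b) := by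
  ext ω
  simp only [Set.mem_inter_iff, Set.mem_union, Set.mem_compl_iff, Set.mem_sdiff,
    knThm2_mem_openConn]
  constructor
  · rintro ⟨⟨⟨⟨-, hb⟩, h3⟩, h1⟩, h2⟩
    exact ⟨⟨fun h => h2 (h1.trans h), fun h => h3 (h1.trans h)⟩, h1.symm, h1.symm.trans hb⟩
  · rintro ⟨⟨h12, h13⟩, h1o, h1b⟩
    exact ⟨⟨⟨⟨Or.inl (Or.inl h1o.symm), h1o.symm.trans h1b⟩, fun h => h13 (h1o.trans h)⟩,
      h1o.symm⟩, fun h => h12 (h1o.trans h)⟩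

/-- `T₂`: on `{o↔A, o↔b, o↮a₃}`, the part `{o↮a₁}` is `N₂ ∩ {a₂↔o} ∩ {a₂↔b}`.
[cite: KozmaNitzan2024, Theorem 2, proof (p. 8)] -/
theorem knThm2_setA4 (o b a₁ a₂ a₃ : Fin n) :
    ((((openConn o a₁ ∪ openConn o a₂ ∪ openConn o a₃) ∩ openConn o b) \ openConn o a₃) \
        openConn o a₁ : Set (BondConfig (Fin n))) =
      (openConn a₂ a₁)ᶜ ∩ (openConn a₂ a₃)ᶜ ∩ (openConn a₂ o ∩ openConn a₂ b) := by
  ext ω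
  simp only [Set.mem_inter_iff, Set.mem_union, Set.mem_compl_iff, Set.mem_sdiff,
    knThm2_mem_openConn]
  constructor
  · rintro ⟨⟨⟨hA, hb⟩, h3⟩, h1⟩
    have h2 : (openGraph ω).Reachable o a₂ := by
      rcases hA with (h | h) | h
      exacts [absurd h h1, h, absurd h h3]
    exact ⟨⟨fun h => h1 (h2.trans h), fun h => h3 (h2.trans h)⟩, h2.symm, h2.symm.trans hb⟩
  · rintro ⟨⟨h21, h23⟩, h2o, h2b⟩
    exact ⟨⟨⟨Or.inl (Or.inr h2o.symm), h2o.symm.trans h2b⟩, fun h => h23 (h2o.trans h)⟩,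
      fun h => h21 (h2o.trans h)⟩

/-- **Partition A** (KN p. 8, expansion of `P(0 ↔ b, 0 ↔ A)` by `𝒞(0) ∩ A`):
`μ(o↔A, o↔b) = μ(o↔A, o↔b, o↔a₃) + T₁₂ + T₁ + T₂`.
[cite: KozmaNitzan2024, Theorem 2, proof (p. 8, first display)] -/
theorem knThm2_partA (w : Sym2 (Fin n) → unitInterval) (o b a₁ a₂ a₃ : Fin n) :
    (prodBernoulli w).real ((openConn o a₁ ∪ openConn o a₂ ∪ openConn o a₃) ∩ openConn o b) =
      (prodBernoulli w).real
          ((openConn o a₁ ∪ openConn o a₂ ∪ openConn o a₃) ∩ openConn o b ∩ openConn o a₃) +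
        ((prodBernoulli w).real ((openConn a₁ a₃)ᶜ ∩ (openConn a₂ a₃)ᶜ ∩
              ((openConn a₁ o ∪ openConn a₂ o) ∩ (openConn a₁ b ∩ openConn a₂ b))) +
            (prodBernoulli w).real
              ((openConn a₁ a₂)ᶜ ∩ (openConn a₁ a₃)ᶜ ∩ (openConn a₁ o ∩ openConn a₁ b)) +
          (prodBernoulli w).real
            ((openConn a₂ a₁)ᶜ ∩ (openConn a₂ a₃)ᶜ ∩ (openConn a₂ o ∩ openConn a₂ b))) := by
  have hm : ∀ s : Set (BondConfig (Fin n)), MeasurableSet s := fun _ => MeasurableSet.of_discrete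
  have h1 := measureReal_inter_add_sdiff (μ := prodBernoulli w)
    (s := (openConn o a₁ ∪ openConn o a₂ ∪ openConn o a₃) ∩ openConn o b) (hm (openConn o a₃))
  have h2 := measureReal_inter_add_sdiff (μ := prodBernoulli w)
    (s := ((openConn o a₁ ∪ openConn o a₂ ∪ openConn o a₃) ∩ openConn o b) \ openConn o a₃)
    (hm (openConn o a₁))
  have h3 := measureReal_inter_add_sdiff (μ := prodBernoulli w)
    (s := (((openConn o a₁ ∪ openConn o a₂ ∪ openConn o a₃) ∩ openConn o b) \ openConn o a₃) ∩
      openConn o a₁) (hm (openConn o a₂))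
  rw [knThm2_setA2, knThm2_setA3] at h3
  rw [knThm2_setA4] at h2
  linarith

/-! ### Partition B: `{o ↔ A} ∩ {a₃ ↔ b}` by `C(b) ∩ A` -/

/-- On `{o ↔ A}`: `{a₃↔b} ∩ {o↔b} = {o↔b} ∩ {o↔a₃}` (the terms `T ∋ 3` cancel).
[cite: KozmaNitzan2024, Theorem 2, proof (p. 8, "Subtracting these two equations all terms for T ∋ 3 cancel")] -/
theorem knThm2_setB1 (o b a₁ a₂ a₃ : Fin n) :
    ((openConn o a₁ ∪ openConn o a₂ ∪ openConn o a₃) ∩ openConn a₃ b ∩ openConn o b :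
        Set (BondConfig (Fin n))) =
      (openConn o a₁ ∪ openConn o a₂ ∪ openConn o a₃) ∩ openConn o b ∩ openConn o a₃ := by
  ext ω
  simp only [Set.mem_inter_iff, knThm2_mem_openConn]
  constructor
  · rintro ⟨⟨hA, h3b⟩, hb⟩
    exact ⟨⟨hA, hb⟩, hb.trans h3b.symm⟩
  · rintro ⟨⟨hA, hb⟩, h3⟩
    exact ⟨⟨hA, h3.symm.trans hb⟩, hb⟩

/-- `U₁`: on `{o↔A, a₃↔b, o↮b}`, the part `{a₂↔b}` is `N₁ ∩ {a₁↔o} ∩ {a₂↔b} ∩ {a₃↔b}`.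
[cite: KozmaNitzan2024, Theorem 2, proof (p. 8, second display)] -/
theorem knThm2_setB2 (o b a₁ a₂ a₃ : Fin n) :
    ((((openConn o a₁ ∪ openConn o a₂ ∪ openConn o a₃) ∩ openConn a₃ b) \ openConn o b) ∩
        openConn a₂ b : Set (BondConfig (Fin n))) =
      (openConn a₁ a₂)ᶜ ∩ (openConn a₁ a₃)ᶜ ∩
        (openConn a₁ o ∩ (openConn a₂ b ∩ openConn a₃ b)) := by
  ext ω
  simp only [Set.mem_inter_iff, Set.mem_union, Set.mem_compl_iff, Set.mem_sdiff,
    knThm2_mem_openConn]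
  constructor
  · rintro ⟨⟨⟨hA, h3b⟩, hb⟩, h2b⟩
    have h1 : (openGraph ω).Reachable o a₁ := by
      rcases hA with (h | h) | h
      exacts [h, absurd (h.trans h2b) hb, absurd (h.trans h3b) hb]
    exact ⟨⟨fun h => hb ((h1.trans h).trans h2b), fun h => hb ((h1.trans h).trans h3b)⟩,
      h1.symm, h2b, h3b⟩
  · rintro ⟨⟨h12, -⟩, h1o, h2b, h3b⟩
    exact ⟨⟨⟨Or.inl (Or.inl h1o.symm), h3b⟩, fun h => h12 ((h1o.trans h).trans h2b.symm)⟩, h2b⟩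

/-- `U₂`: on `{o↔A, a₃↔b, o↮b, a₂↮b}`, the part `{a₁↔b}` is
`N₂ ∩ {a₂↔o} ∩ {a₁↔b} ∩ {a₃↔b}`. [cite: KozmaNitzan2024, Theorem 2, proof (p. 8, second display)] -/
theorem knThm2_setB3 (o b a₁ a₂ a₃ : Fin n) :
    (((((openConn o a₁ ∪ openConn o a₂ ∪ openConn o a₃) ∩ openConn a₃ b) \ openConn o b) \
        openConn a₂ b) ∩ openConn a₁ b : Set (BondConfig (Fin n))) =
      (openConn a₂ a₁)ᶜ ∩ (openConn a₂ a₃)ᶜ ∩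
        (openConn a₂ o ∩ (openConn a₁ b ∩ openConn a₃ b)) := by
  ext ω
  simp only [Set.mem_inter_iff, Set.mem_union, Set.mem_compl_iff, Set.mem_sdiff,
    knThm2_mem_openConn]
  constructor
  · rintro ⟨⟨⟨⟨hA, h3b⟩, hb⟩, h2b⟩, h1b⟩
    have h2 : (openGraph ω).Reachable o a₂ := by
      rcases hA with (h | h) | h
      exacts [absurd (h.trans h1b) hb, h, absurd (h.trans h3b) hb]
    exact ⟨⟨fun h => hb ((h2.trans h).trans h1b), fun h => hb ((h2.trans h).trans h3b)⟩,
      h2.symm, h1b, h3b⟩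
  · rintro ⟨⟨h21, -⟩, h2o, h1b, h3b⟩
    exact ⟨⟨⟨⟨Or.inl (Or.inr h2o.symm), h3b⟩, fun h => h21 ((h2o.trans h).trans h1b.symm)⟩,
      fun h => h21 (h.trans h1b.symm)⟩, h1b⟩

/-- `U₁₂`: on `{o↔A, a₃↔b, o↮b}`, the part `{a₁↮b, a₂↮b}` is
`N₁₂ ∩ ({a₁↔o} ∪ {a₂↔o}) ∩ {a₃↔b}`. [cite: KozmaNitzan2024, Theorem 2, proof (p. 8, second display)] -/
theorem knThm2_setB4 (o b a₁ a₂ a₃ : Fin n) :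
    (((((openConn o a₁ ∪ openConn o a₂ ∪ openConn o a₃) ∩ openConn a₃ b) \ openConn o b) \
        openConn a₂ b) \ openConn a₁ b : Set (BondConfig (Fin n))) =
      (openConn a₁ a₃)ᶜ ∩ (openConn a₂ a₃)ᶜ ∩
        ((openConn a₁ o ∪ openConn a₂ o) ∩ openConn a₃ b) := by
  ext ω
  simp only [Set.mem_inter_iff, Set.mem_union, Set.mem_compl_iff, Set.mem_sdiff,
    knThm2_mem_openConn]
  constructor
  · rintro ⟨⟨⟨⟨hA, h3b⟩, hb⟩, h2b⟩, h1b⟩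
    have hS : (openGraph ω).Reachable a₁ o ∨ (openGraph ω).Reachable a₂ o := by
      rcases hA with (h | h) | h
      exacts [Or.inl h.symm, Or.inr h.symm, absurd (h.trans h3b) hb]
    exact ⟨⟨fun h => h1b (h.trans h3b), fun h => h2b (h.trans h3b)⟩, hS, h3b⟩
  · rintro ⟨⟨h13, h23⟩, hS, h3b⟩
    refine ⟨⟨⟨⟨?_, h3b⟩, fun h => ?_⟩, fun h => h23 (h.trans h3b.symm)⟩,
      fun h => h13 (h.trans h3b.symm)⟩
    · exact hS.elim (fun h => Or.inl (Or.inl h.symm)) fun h => Or.inl (Or.inr h.symm)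
    · exact hS.elim (fun h' => h13 ((h'.trans h).trans h3b.symm))
        fun h' => h23 ((h'.trans h).trans h3b.symm)

/-- **Partition B** (KN p. 8, expansion of `P(0 ↔ A, 3 ↔ b)` by `𝒞(b) ∩ A`, the terms with
`o ↔ b` collected into `μ(o↔A, o↔b, o↔a₃)`):
`μ(o↔A, a₃↔b) = μ(o↔A, o↔b, o↔a₃) + U₁ + U₂ + U₁₂`.
[cite: KozmaNitzan2024, Theorem 2, proof (p. 8, second display)] -/
theorem knThm2_partB (w : Sym2 (Fin n) → unitInterval) (o b a₁ a₂ a₃ : Fin n) :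
    (prodBernoulli w).real ((openConn o a₁ ∪ openConn o a₂ ∪ openConn o a₃) ∩ openConn a₃ b) =
      (prodBernoulli w).real
          ((openConn o a₁ ∪ openConn o a₂ ∪ openConn o a₃) ∩ openConn o b ∩ openConn o a₃) +
        ((prodBernoulli w).real ((openConn a₁ a₂)ᶜ ∩ (openConn a₁ a₃)ᶜ ∩
              (openConn a₁ o ∩ (openConn a₂ b ∩ openConn a₃ b))) +
            (prodBernoulli w).real ((openConn a₂ a₁)ᶜ ∩ (openConn a₂ a₃)ᶜ ∩
              (openConn a₂ o ∩ (openConn a₁ b ∩ openConn a₃ b))) +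
          (prodBernoulli w).real ((openConn a₁ a₃)ᶜ ∩ (openConn a₂ a₃)ᶜ ∩
              ((openConn a₁ o ∪ openConn a₂ o) ∩ openConn a₃ b))) := by
  have hm : ∀ s : Set (BondConfig (Fin n)), MeasurableSet s := fun _ => MeasurableSet.of_discrete
  have h1 := measureReal_inter_add_sdiff (μ := prodBernoulli w)
    (s := (openConn o a₁ ∪ openConn o a₂ ∪ openConn o a₃) ∩ openConn a₃ b) (hm (openConn o b))
  have h2 := measureReal_inter_add_sdiff (μ := prodBernoulli w)
    (s := ((openConn o a₁ ∪ openConn o a₂ ∪ openConn o a₃) ∩ openConn a₃ b) \ openConn o b)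
    (hm (openConn a₂ b))
  have h3 := measureReal_inter_add_sdiff (μ := prodBernoulli w)
    (s := (((openConn o a₁ ∪ openConn o a₂ ∪ openConn o a₃) ∩ openConn a₃ b) \ openConn o b) \
      openConn a₂ b) (hm (openConn a₁ b))
  rw [knThm2_setB3, knThm2_setB4] at h3
  rw [knThm2_setB2] at h2
  rw [knThm2_setB1] at h1
  linarith

/-- **Registered sub-goal `stub_knThm2GoodSplit`** (this file's deciding statement): KN's
identity `P(0↔b, 0↔A) − P(0↔A, 3↔b) = I + II + III` (Theorem 2, p. 8), on `Fin n` with the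
six terms written on the separation events `N₁₂, N₁, N₂` (from `knThm2_partA/B`).
[cite: KozmaNitzan2024, Theorem 2, proof (p. 8, "P(0↔b,0↔A) − P(0↔A,3↔b) = I + II + III")] -/
theorem stub_knThm2GoodSplit : ∀ (n : ℕ) (w : Sym2 (Fin n) → unitInterval) (o b a₁ a₂ a₃ : Fin n), (prodBernoulli w).real ((openConn o a₁ ∪ openConn o a₂ ∪ openConn o a₃) ∩ openConn o b) - (prodBernoulli w).real ((openConn o a₁ ∪ openConn o a₂ ∪ openConn o a₃) ∩ openConn a₃ b) = ((prodBernoulli w).real ((openConn a₁ a₃)ᶜ ∩ (openConn a₂ a₃)ᶜ ∩ ((openConn a₁ o ∪ openConn a₂ o) ∩ (openConn a₁ b ∩ openConn a₂ b))) - (prodBernoulli w).real ((openConn a₁ a₃)ᶜ ∩ (openConn a₂ a₃)ᶜ ∩ ((openConn a₁ o ∪ openConn a₂ o) ∩ openConn a₃ b))) + ((prodBernoulli w).real ((openConn a₁ a₂)ᶜ ∩ (openConn a₁ a₃)ᶜ ∩ (openConn a₁ o ∩ openConn a₁ b)) - (prodBernoulli w).real ((openConn a₁ a₂)ᶜ ∩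 (openConn a₁ a₃)ᶜ ∩ (openConn a₁ o ∩ (openConn a₂ b ∩ openConn a₃ b)))) + ((prodBernoulli w).real ((openConn a₂ a₁)ᶜ ∩ (openConn a₂ a₃)ᶜ ∩ (openConn a₂ o ∩ openConn a₂ b)) - (prodBernoulli w).real ((openConn a₂ a₁)ᶜ ∩ (openConn a₂ a₃)ᶜ ∩ (openConn a₂ o ∩ (openConn a₁ b ∩ openConn a₃ b)))) := by
  intro n w o b a₁ a₂ a₃
  have hA := knThm2_partA w o b a₁ a₂ a₃
  have hB := knThm2_partB w o b a₁ a₂ a₃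
  linarith

end

end Summit.CriticalPhenomena.PercolationContinuityZ3.Theorems
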